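import Summits.QuantumFields.BalabanUV.Beta.MixedJetTablesPlug
import Literature.MathematicalPhysics.QuantumFieldTheory.Balaban1983to89.Beta.OneStepKernelFamily
import Literature.MathematicalPhysics.QuantumFieldTheory.Balaban1983to89.Beta.Drift
import Literature.MathematicalPhysics.QuantumFieldTheory.Balaban1983to89.T4Continuum

/-!
# Crux K2⁷ `EndpointGivenBR13SepCoPH` — THE NAMED STEP JETS OF RECORD `JsOfRecord F κ : ℕ → JetData 3 F.L`, their one-loop numbers
# `beta0OfJs F κ j := secondMoment (TbalOf F.L (JsOfRecord F κ) j) 0 1`, and the split-free END over a NAMED reference sequence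
# (`BoxRemainder`, `endpointExistence_of_drift_boxRemainder`, `boxRemainder_unique`)

Cell `ym-nodeO-ideate`, DEFINER seat `ym-nodeO-def-1` (director-ym R361 ∕ LINE №200; CRIT-1 verdict on the crux idea card
`Cruxes/EndpointGivenBR13SepCoPH/Ideas/jets-referenced-box.md`, sheet `Cruxes/EndpointGivenBR13SepCoPH/CRIT-1-jets-referenced-box.md`);
helper for crux K2⁷ = stmt-QuantumFields-20543 (`Summit.QuantumFields.YangMills.Theses.BalabanUVNodes.EndpointGivenBR13SepCoPH`, route
`BalabanUVNodes`), landed `--supports 20543 --as helper`; count-neutral.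

WHY.  The registered K2⁷ skeleton (sha16 `6c3fc4f2e0bdd8aa`, stubs `stub_d1Residue13 : D1AtRecord13`, `stub_d4AtSlopeCont13 :
D4AtSlopeOfD1Record13`) keys both stubs to the reference sequence `Node00.beta0OfMerged βm θ.v₀ j = limUnder (𝓝[>] 0) (g ↦ βm j (update (θ.v₀ j) last g))`
(`Node00/BetaOfRecord.lean`), where `v₀` is a FREE field of `Node00.Stage8Params` that admissibility never reads and that every record of
record sets to the ZERO history (`Node00/Record12Numerics.lean`, `Node00/Record12NumericsFamilyDict.lean`, `Node00/Record8Inhabited.lean`: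
`v₀ := fun _ _ => 0`) — a one-sided limit through histories `(0, …, 0, g)` outside [I] Thm 3's `0 < g_k ≤ γ ∀ k` (p. 264), possibly the junk value
of `limUnder` (CRIT-1 sheet §1, verified in the tree).  The endpoint road never needed that OBJECT: `FlowStepRuns.endpointExistence_of_partialSums`
consumes only SOME reference sequence `b : ℕ → ℝ` drifting with a positive slope (`Beta.Drift.OneLoopDrift`) together with a box remainder
`|β_{k+1}(g_0, …, g_k) − b_k| ≤ C_r·g_k` on `]0, γ₀]`-histories with `C_r γ₀ ≤` slope (§4 below, split-free).  The re-cut keys `b` to the one-loop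
numbers of Bałaban's NAMED dressed step jets at the family's own block `F.L` — the β sub-cell's wall family `OneStepKernelFamily.TbalOf F.L Js`
read at THE literal of record of row (D1), `MixedJetTablesPlug.JsBalAn1Ctr` (= an2's `BalabanStepW2.JsBalT2Of` with an1's node-12b tables
`vh₂SAt`/`mixFFAt` plugged at the centred root, `cE₂ := L^8`; cf. `D1BFx/RoadEndPinned.lean`, `Gaps/D1PinnedNumeralClosedForm.lean`).

LOCATED DESIGN POINT (stated, not hidden).  The (P6) COLOUR ∕ WEIGHT DATUM of the step jets — the three first-order colour weights `cE, cVH, cΛ`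
(`BalabanStepJets.S0`, `BalabanStepJetsSucc.Sstep`), the second-order border weight `cB` and an3's Wilson two-bond position table `Tc`
(`BalabanStepW2.T2Of`) — is NOT pinned anywhere in the tree («(P6) weight pin LAST», cell pub-balaban BETA-SPEC; `Gaps/D1WardNoFreeKnob.lean`:
«(P6) undecided»).  An honest CLOSED literal `∀ F, ℕ → JetData 3 F.L` therefore does not exist today, and this file does NOT invent one: the
datum is carried as ONE structured argument `κ : StepColourData`, `JsOfRecord F κ`.  CONSEQUENCE FOR THE RESHAPE (the planner's, not done
here): two named-jets stubs must SHARE `κ` — either both at a skeleton-level `κ⋆` once the β sub-cell pins (P6), or in the `κ`-free pairing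
«stub 2′ := ∀ F, ∃ κ, ∀ θ …, box remainder of the record's β w.r.t. `beta0OfJs F κ`» ∕ «stub 1′ := ∀ F κ θ …, that box remainder → `D1Drift F.L
(JsOfRecord F κ) 2 0 1`», which is not a free knob because a box remainder DETERMINES the reference sequence (`boxRemainder_unique`, §4).

WHAT IS HERE (2 `def` + 1 `structure` + 1 `def … : Prop` hypothesis shape + 13 theorems; 0 `sorry`; everything [folklore] bookkeeping BY NAME):
* §0 (no declaration) the block facts `1 ≤ F.L` ∕ `NeZero F.L` are inline terms from `T4Family.hL` (the named forms are landed elsewhere).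
* §1 `StepColourData` — the (P6) slot `(cE, cVH, cΛ, cB, Tc)`.
* §2 **`JsOfRecord F κ : ℕ → JetData 3 F.L`** `:= JsBalAn1Ctr F.hL.2.le κ.cE κ.cVH κ.cΛ ((F.L : ℝ) ^ (2·(3+1))) κ.cB κ.Tc` (the `NeZero F.L`
  instance built inline from `F.hL`, so the term is closed in `F, κ`); `JsOfRecord_eq` (`rfl` against the D1 literal under any ambient
  instance), `TbalOf_JsOfRecord` (the wall's family member by member in closed `Π`-form — `MixedJetTablesPlug.TbalOf_JsBalAn1Ctr` BY NAME),
  `JsOfRecord_S_translate` ∕ `JsOfRecord_W_translate` ((St♭)∕(Wt) sockets BY NAME).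
* §3 **`beta0OfJs F κ j := secondMoment (TbalOf F.L (JsOfRecord F κ) j) 0 1`** — THE NAMED ONE-LOOP NUMBERS (channel `(0, 1)` as in the K2⁷ stubs);
  `beta0OfJs_eq`, `d1Drift_JsOfRecord_iff` (`D1Drift F.L (JsOfRecord F κ) N 0 1 ↔ ∃ A, OneLoopDrift (stepBal N F.L) A (beta0OfJs F κ)`, `Iff.rfl`),
  `d1Drift_JsOfRecord_iff_JsBalAn1Ctr` (row (D1)'s wall statement at `Lc := F.L`, `Iff.rfl`), `stepBal_L_pos` (`0 < stepBal N F.L` for `0 < N`).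
* §4 THE SPLIT-FREE END OVER A NAMED REFERENCE SEQUENCE (generic `β : HBeta`, `b : ℕ → ℝ`): `BoxRemainder β b Cr γ₀` (hypothesis shape:
  `∀ k p ∈ HistBox γ₀ k, |β k p − b k| ≤ Cr·p (Fin.last k)` — [I] (2.13)'s «vanishes at g_k = 0» in the g-PROPORTIONAL form print offers on p. 266
  and never carries out; rows (D4)∕B4 re-referenced), `BoxRemainder.mono`, `betaPartialSumsLowerH_of_drift_boxRemainder` (drift of `b` with slope `s`
  + box remainder with `Cr γ₀ ≤ s` ⇒ `BetaPartialSumsLowerH (2A) γ₀ β` — `Beta.Drift.betaPartialSumsLowerH_of_drift`'s proof with the split removed),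
  **`endpointExistence_of_drift_boxRemainder`** (+ (C) + the printed upper bound ⇒ `DagBinding.EndpointExistence C` for forward-generated `C`;
  `FlowStepRuns.endpointExistence_of_partialSums` BY NAME), **`boxRemainder_unique`** (two reference sequences with box remainders for the SAME β
  coincide — so a named-jets remainder stub pins `beta0OfJs F κ` outright and the colour datum is no free knob under it), and the named-jets corollary
  `endpointExistence_of_d1Drift_boxRemainder_JsOfRecord`.

HONEST FRAMING.  Definitions + elementary real bookkeeping; NOTHING of Bałaban's analysis is asserted: `D1Drift F.L (JsOfRecord F κ) 2 0 1` (row (D1),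
the one-shot law for Bałaban's stencils) and any `BoxRemainder` of a record's β (rows (D4)∕B4 + the identification of the record's one-loop numbers with
`beta0OfJs`) are HYPOTHESES wherever they occur; (P6) is NOT decided here (no value of any colour weight is chosen); K2⁷ ∕ its stubs ∕ N25 ∕ N26 NOT proved;
counts unmoved; [Balaban1987RG1] Thm 2 + (0.31) p. 259 (NODE O) is UNPROVED IN PRINT; route R4 closes the conditional finite-𝕋⁴ rung only — NOT the
continuum limit, NOT ℝ⁴, NOT OS, NOT a mass gap, NOT Clay.  No `instance`, no `notation`, no `axiom`.
Sources (context only; nothing printed is used as a hypothesis): [I] = [Balaban1987RG1] CMP **109** (1987): Thm 2 p. 259 (first sentence), Thm 3 +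
(1.20)–(1.22) p. 264, (2.12)–(2.15) p. 268 («the expression under the exponential above vanishes at g_k = 0»), p. 266, (5.10) p. 293; [II] =
[Balaban1988RG2Cluster] CMP **116** (1988): Lemma 3 (2.38) p. 20.
-/

noncomputable section

namespace Summit.QuantumFields.YangMills.Theorems.BalabanUVNodesK2JsOfRecord

open Finset
open scoped BigOperators
open Literature.MathematicalPhysics.QuantumFieldTheory.Balaban1983to89
open Literature.MathematicalPhysics.QuantumFieldTheory.Balaban1983to89.FlowStep
open Literature.MathematicalPhysics.QuantumFieldTheory.Balaban1983to89.FlowStepRuns (BetaPartialSumsLowerH endpointExistence_of_partialSums)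
open Literature.MathematicalPhysics.QuantumFieldTheory.Balaban1983to89.DagBinding (EndpointExistence ForwardGenerated)
open Literature.MathematicalPhysics.QuantumFieldTheory.Balaban1983to89.T4Continuum (T4Family)
open Literature.MathematicalPhysics.QuantumFieldTheory.Balaban1983to89.B12Beta (secondMoment HistBox)
open Literature.MathematicalPhysics.QuantumFieldTheory.Balaban1983to89.Beta
open Literature.MathematicalPhysics.QuantumFieldTheory.Balaban1983to89.Beta.ExpKernelCalculus (shiftK hessKer)
open Literature.MathematicalPhysics.QuantumFieldTheory.Balaban1983to89.Beta.OneStepResolventKernel (JetData)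
open Literature.MathematicalPhysics.QuantumFieldTheory.Balaban1983to89.Beta.OneStepKernelFamily (KInvStep TbalOf D1Drift)
open Literature.MathematicalPhysics.QuantumFieldTheory.Balaban1983to89.Beta.Drift (OneLoopDrift sum_Ico_ge_of_drift)
open Literature.MathematicalPhysics.QuantumFieldTheory.Balaban1983to89.Beta.AxialDressing (axDressK axVertexOfK)
open Literature.MathematicalPhysics.QuantumFieldTheory.Balaban1983to89.Beta.AffineAveraging (toSite)
open Literature.MathematicalPhysics.QuantumFieldTheory.Balaban1983to89.Beta.AveragingContoursRooted (ctrOff ctrOff_mem_box)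
open Literature.MathematicalPhysics.QuantumFieldTheory.Balaban1983to89.Beta.AveragingMixedJetTables (vh₂SAt mixFFAt)
open Literature.MathematicalPhysics.QuantumFieldTheory.Balaban1983to89.Beta.BalabanStepJetsSucc (JsBal0Of)
open Literature.MathematicalPhysics.QuantumFieldTheory.Balaban1983to89.Beta.BalabanStepW2 (T2Of_loc CwOf δwOf δwOf_pos WbalOf_loc₂ WbalT2Of)
open Summit.QuantumFields.BalabanUV.Beta.MixedJetTablesPlug (JsBalAn1Ctr TbalOf_JsBalAn1Ctr JsBalAn1Ctr_S_translate JsBalAn1Ctr_W_translate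
  hB_an1 hmix_an1)

/-! ## §0 The family's block

No declaration: `1 ≤ F.L` is the term `F.hL.2.le` (`T4Family.hL : Odd L ∧ 1 < L`) and the `NeZero F.L` fact (a `Prop`) is built inline
inside `JsOfRecord` ∕ `beta0OfJs`, so that those terms are closed in `F, κ`; statements about `TbalOf F.L …` take the ambient `[NeZero F.L]`
as the tree does (`BalabanUVNodesN26SlopeOfRecord13`), any two instances agreeing by proof irrelevance.  The landed named forms are
`HistoryFlow.two_le_L`, `HistoryRealiseCellsRunHeadlinePos.one_le_L`, `N15.AtKeyedHome.neZero_blockFactor` (not imported: heavy chains). -/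

/-! ## §1 The (P6) colour ∕ weight datum of the step jets — a SLOT, not a value -/

/-- **THE (P6) COLOUR ∕ WEIGHT DATUM OF BAŁABAN's STEP JETS** as typed by the β sub-cell: the three first-order colour weights `cE` (value-function
third jet ∕ Wilson cubic vertex), `cVH` (the one-step averaging border), `cΛ` (the Lagrange stencil), the second-order border weight `cB`, and an3's
Wilson two-bond position table `Tc` (`BalabanStepW2.T2Of`'s `T`).  Work-order (P6) of that cell («pinned LAST») decides their values for `SU(N)` at
block `L`; NOTHING is decided here — this structure is the slot the K2⁷ named-jets stubs quantify or a later pin `StepColourData`-valued definition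
fills.  (The second-order value weight `cE₂` is NOT a field: the literal of record pins it to `L^{2(d+1)} = L^8`.) [folklore] -/
structure StepColourData where
  /-- weight of the value-function third jet `E‴` ∕ Wilson cubic vertex in the first-order stencil -/
  cE : ℝ
  /-- weight of the one-step averaging field–multiplier border `mfNeg vhS` -/
  cVH : ℝ
  /-- weight of the Lagrange stencil `SLam …` -/
  cΛ : ℝ
  /-- weight of the second-order averaging border `mfNeg ∘ vh₂S` -/
  cB : ℝ
  /-- an3's Wilson two-bond position table (`WilsonBiStencil.wilsonW₂ 3 Tc`) -/
  Tc : Fin 4 → Fin 4 → Fin 4 → Fin 4 → ℝ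

/-! ## §2 The named step jets of record at the family's own block -/

/-- **THE NAMED DRESSED STEP JETS OF RECORD AT THE FAMILY's OWN BLOCK `F.L`**: the β sub-cell's row-(D1) literal of record
`MixedJetTablesPlug.JsBalAn1Ctr` (an2's dressed family `dress ∘ JsBal⁰` with the recursive second-order tables `T2Of`, an1's node-12b borders
`vh₂SAt`/`mixFFAt` at the centred root `ctrOff 4 L`, `cE₂ := L^8`) at `Lc := F.L`, colour ∕ weight datum `κ` ((P6) slot, §1).  The reference the K2⁷
named-jets stubs read is `j ↦ secondMoment (TbalOf F.L (JsOfRecord F κ) j) 0 1` (§3).  A definition asserting nothing. [folklore] -/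
def JsOfRecord (F : T4Family) (κ : StepColourData) : ℕ → JetData 3 F.L :=
  haveI : NeZero F.L := ⟨by have := F.hL.2; omega⟩
  JsBalAn1Ctr F.hL.2.le κ.cE κ.cVH κ.cΛ ((F.L : ℝ) ^ (2 * (3 + 1))) κ.cB κ.Tc

variable (F : T4Family) [NeZero F.L] (κ : StepColourData)

/-- `JsOfRecord F κ` IS the row-(D1) literal `JsBalAn1Ctr` at `Lc := F.L` with the `L^8` pin, under any ambient `NeZero F.L` (`rfl`). [folklore] -/
theorem JsOfRecord_eq : JsOfRecord F κ = JsBalAn1Ctr F.hL.2.le κ.cE κ.cVH κ.cΛ ((F.L : ℝ) ^ (2 * (3 + 1))) κ.cB κ.Tc := rfl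

/-- **THE WALL's FAMILY AT THE NAMED JETS, MEMBER BY MEMBER, IN CLOSED `Π`-FORM** (`MixedJetTablesPlug.TbalOf_JsBalAn1Ctr` BY NAME at `Lc := F.L`,
`cE₂ := L^8`). [folklore] -/
theorem TbalOf_JsOfRecord (j : ℕ) :
    TbalOf F.L (JsOfRecord F κ) j
      = hessKer (axDressK F.L (KInvStep (d := 3) F.L j))
          (axVertexOfK (KInvStep (d := 3) F.L j) F.L
            (JsBal0Of F.hL.2.le κ.cE κ.cVH κ.cΛ
              (WbalT2Of (Lc := F.L) κ.cE κ.cVH κ.cΛ ((F.L : ℝ) ^ (2 * (3 + 1))) κ.cB κ.Tc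
                (vh₂S := vh₂SAt (toSite (ctrOff (3 + 1) F.L)) F.L) (mixFF := mixFFAt (toSite (ctrOff (3 + 1) F.L)) F.L))
              (CwOf F.hL.2.le κ.cE κ.cVH κ.cΛ (T2Of_loc F.hL.2.le κ.cE κ.cVH κ.cΛ ((F.L : ℝ) ^ (2 * (3 + 1))) κ.cB κ.Tc
                (hB_an1 F.hL.2.le (ctrOff_mem_box F.hL.2.le)) (hmix_an1 F.hL.2.le (ctrOff_mem_box F.hL.2.le)))
                (hmix_an1 F.hL.2.le (ctrOff_mem_box F.hL.2.le)))
              (δwOf F.hL.2.le κ.cE κ.cVH κ.cΛ (T2Of_loc F.hL.2.le κ.cE κ.cVH κ.cΛ ((F.L : ℝ) ^ (2 * (3 + 1))) κ.cB κ.Tc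
                (hB_an1 F.hL.2.le (ctrOff_mem_box F.hL.2.le)) (hmix_an1 F.hL.2.le (ctrOff_mem_box F.hL.2.le)))
                (hmix_an1 F.hL.2.le (ctrOff_mem_box F.hL.2.le)))
              (δwOf_pos F.hL.2.le κ.cE κ.cVH κ.cΛ (T2Of_loc F.hL.2.le κ.cE κ.cVH κ.cΛ ((F.L : ℝ) ^ (2 * (3 + 1))) κ.cB κ.Tc
                (hB_an1 F.hL.2.le (ctrOff_mem_box F.hL.2.le)) (hmix_an1 F.hL.2.le (ctrOff_mem_box F.hL.2.le)))
                (hmix_an1 F.hL.2.le (ctrOff_mem_box F.hL.2.le)))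
              (WbalOf_loc₂ F.hL.2.le κ.cE κ.cVH κ.cΛ (T2Of_loc F.hL.2.le κ.cE κ.cVH κ.cΛ ((F.L : ℝ) ^ (2 * (3 + 1))) κ.cB κ.Tc
                (hB_an1 F.hL.2.le (ctrOff_mem_box F.hL.2.le)) (hmix_an1 F.hL.2.le (ctrOff_mem_box F.hL.2.le)))
                (hmix_an1 F.hL.2.le (ctrOff_mem_box F.hL.2.le)))
              j).S)
          (WbalT2Of (Lc := F.L) κ.cE κ.cVH κ.cΛ ((F.L : ℝ) ^ (2 * (3 + 1))) κ.cB κ.Tc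
            (vh₂S := vh₂SAt (toSite (ctrOff (3 + 1) F.L)) F.L) (mixFF := mixFFAt (toSite (ctrOff (3 + 1) F.L)) F.L) j) :=
  TbalOf_JsBalAn1Ctr F.hL.2.le κ.cE κ.cVH κ.cΛ ((F.L : ℝ) ^ (2 * (3 + 1))) κ.cB κ.Tc j

/-- **(St♭) FOR THE NAMED JETS**: every member's first-order stencil is covariant under the block translations `u ↦ u + L•t` of the step lattice
(`MixedJetTablesPlug.JsBalAn1Ctr_S_translate` BY NAME). [folklore] -/
theorem JsOfRecord_S_translate (j : ℕ) (κ' : Fin (3 + 1)) (u t : Fin (3 + 1) → ℤ) :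
    (JsOfRecord F κ j).S κ' (u + (F.L : ℤ) • t) = shiftK (-((F.L : ℤ) • t)) ((JsOfRecord F κ j).S κ' u) :=
  JsBalAn1Ctr_S_translate F.hL.2.le κ.cE κ.cVH κ.cΛ ((F.L : ℝ) ^ (2 * (3 + 1))) κ.cB κ.Tc j κ' u t

/-- **(Wt) FOR THE NAMED JETS**: every member's second-order tables are block-covariant (`MixedJetTablesPlug.JsBalAn1Ctr_W_translate` BY NAME). [folklore] -/
theorem JsOfRecord_W_translate (j : ℕ) (μ : Fin (3 + 1)) (y : Fin (3 + 1) → ℤ) (ν : Fin (3 + 1)) (y' t : Fin (3 + 1) → ℤ) :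
    (JsOfRecord F κ j).W μ (y + t) ν (y' + t) = shiftK (-((F.L : ℤ) • t)) ((JsOfRecord F κ j).W μ y ν y') :=
  JsBalAn1Ctr_W_translate F.hL.2.le κ.cE κ.cVH κ.cΛ ((F.L : ℝ) ^ (2 * (3 + 1))) κ.cB κ.Tc j μ y ν y' t

/-! ## §3 The named one-loop numbers -/

/-- **THE NAMED ONE-LOOP NUMBERS OF THE STEP JETS OF RECORD**, channel `(0, 1)`: `β⁰_j(F, κ) := Σ_x Π_j(x) x₀ x₁` ((1.22)-type second moment,
`B12Beta.secondMoment`) of the typed step-`j` kernel `TbalOf F.L (JsOfRecord F κ) j` — the REFERENCE SEQUENCE the re-keyed K2⁷ stubs read in place of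
`Node00.beta0OfMerged … θ.v₀` (no `limUnder`, no reference history, no `OneLoopSplit` object).  History-free and coupling-free BY TYPING; whether these
numbers ARE the one-loop part of a record's merged β is a HYPOTHESIS of the remainder stub (`BoxRemainder`, §4), never asserted.  (`NeZero F.L`
supplied internally.) [folklore] -/
def beta0OfJs (F : T4Family) (κ : StepColourData) (j : ℕ) : ℝ :=
  haveI : NeZero F.L := ⟨by have := F.hL.2; omega⟩
  secondMoment (TbalOf F.L (JsOfRecord F κ) j) 0 1

/-- `beta0OfJs` unfolds to the `(0, 1)` second moment of the wall's family at the named jets, under any ambient `NeZero F.L` (`rfl`). [folklore] -/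
theorem beta0OfJs_eq (j : ℕ) : beta0OfJs F κ j = secondMoment (TbalOf F.L (JsOfRecord F κ) j) 0 1 := rfl

/-- **ROW (D1) OVER THE NAMED JETS IS THE DRIFT OF THE NAMED NUMBERS**: `D1Drift F.L (JsOfRecord F κ) N 0 1 ↔ ∃ A, OneLoopDrift (stepBal N F.L) A
(beta0OfJs F κ)` (`Iff.rfl`; `OneStepKernelFamily.D1Drift`'s body). [folklore] -/
theorem d1Drift_JsOfRecord_iff (N : ℝ) :
    D1Drift F.L (JsOfRecord F κ) N 0 1 ↔ ∃ A : ℝ, OneLoopDrift (B12Normalization.stepBal N F.L) A (beta0OfJs F κ) := Iff.rfl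

/-- **ROW (D1) OVER THE NAMED JETS IS THE β SUB-CELL's WALL STATEMENT AT `Lc := F.L`** (its literal of record `JsBalAn1Ctr … L^8 …`; `Iff.rfl`) — a
(D1) theorem at the pinned literal, instantiated at the family's block, discharges the named-jets stub by `exact`. [folklore] -/
theorem d1Drift_JsOfRecord_iff_JsBalAn1Ctr (N : ℝ) (μ ν : Fin 4) :
    D1Drift F.L (JsOfRecord F κ) N μ ν ↔ D1Drift F.L (JsBalAn1Ctr F.hL.2.le κ.cE κ.cVH κ.cΛ ((F.L : ℝ) ^ (2 * (3 + 1))) κ.cB κ.Tc) N μ ν :=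
  Iff.rfl

omit [NeZero F.L] in
/-- The asymptotic-freedom slope at the family's block is positive for a positive colour numeral: `0 < stepBal N F.L` (`B12Normalization.stepBal_pos`,
`1 < L`). [folklore] -/
theorem stepBal_L_pos {N : ℝ} (hN : 0 < N) : 0 < B12Normalization.stepBal N (F.L : ℝ) :=
  B12Normalization.stepBal_pos hN (by exact_mod_cast F.hL.2)

/-! ## §4 The split-free END over a named reference sequence -/

section End

/-- HYPOTHESIS SHAPE (never a fact): **THE BOX REMAINDER OF `β` RELATIVE TO A REFERENCE SEQUENCE `b`** on `]0, γ₀]`-histories, in the g-PROPORTIONAL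
form — `∀ k, ∀ p ∈ HistBox γ₀ k, |β_{k+1}(p) − b_k| ≤ C_r · p_k` ([I] (2.13): the remainder «vanishes at g_k = 0», offered as `O(g_k)` on p. 266 and
carried out nowhere in print; for a record's β and `b := beta0OfJs F κ` this is rows (D4) ∧ B4 re-referenced to the named numbers).  The shape of
`Beta.Drift.betaPartialSumsLowerH_of_drift`'s `hAF1` with `S.β1 k p` replaced by `β k p − b k` — no `OneLoopSplit` object.  A predicate over
`(β, b, C_r, γ₀)`, never a fact; print context [I] (2.12)–(2.14) p. 268, p. 266. [folklore] -/
def BoxRemainder (β : HBeta) (b : ℕ → ℝ) (Cr γ₀ : ℝ) : Prop :=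
  ∀ (k : ℕ) (p : Fin (k + 1) → ℝ), p ∈ HistBox γ₀ k → |β k p - b k| ≤ Cr * p (Fin.last k)

/-- A box remainder on `]0, γ₀]` restricts to every smaller box `]0, γ₀′]`, `γ₀′ ≤ γ₀`. [folklore] -/
theorem BoxRemainder.mono {β : HBeta} {b : ℕ → ℝ} {Cr γ₀ γ₀' : ℝ} (h : BoxRemainder β b Cr γ₀) (hle : γ₀' ≤ γ₀) :
    BoxRemainder β b Cr γ₀' :=
  fun k p hp => h k p fun i => ⟨(hp i).1, (hp i).2.trans hle⟩

/-- **(A-ps) FROM A DRIFTING REFERENCE SEQUENCE AND A BOX REMAINDER, SPLIT-FREE.**  If `b` drifts with slope `s` up to the cumulative defect `A`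
(`OneLoopDrift s A b`), `β` is within `C_r·g_k` of `b_k` on `]0, γ₀]`-histories, `0 ≤ C_r` and `C_r γ₀ ≤ s`, then the partial sums of `β` along
`]0, γ₀]`-histories are bounded below by `−2A` (`FlowStepRuns.BetaPartialSumsLowerH (2A) γ₀ β`).  The proof of `Beta.Drift.betaPartialSumsLowerH_of_drift`
with `S.β0 ↦ b`, `S.β1 k p ↦ β k p − b k`; no sign of any individual `b_k`, no convergence, no split object. [folklore] -/
theorem betaPartialSumsLowerH_of_drift_boxRemainder {β : HBeta} {b : ℕ → ℝ} {s A Cr γ₀ : ℝ} (hdrift : OneLoopDrift s A b)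
    (hrem : BoxRemainder β b Cr γ₀) (hCr : 0 ≤ Cr) (hγ : Cr * γ₀ ≤ s) : BetaPartialSumsLowerH (2 * A) γ₀ β := by
  intro g hg k n hkn
  have hstep : ∀ j, b j - s ≤ β j (prefixOf g j) := fun j => by
    have hp : prefixOf g j ∈ HistBox γ₀ j := fun i => hg i
    have h2 := abs_le.mp (hrem j _ hp)
    have hlast : Cr * prefixOf g j (Fin.last j) ≤ Cr * γ₀ := mul_le_mul_of_nonneg_left (hp (Fin.last j)).2 hCr
    linarith [h2.1]
  have hsum : ∑ j ∈ Finset.Ico k n, (b j - s) ≤ ∑ j ∈ Finset.Ico k n, β j (prefixOf g j) :=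
    Finset.sum_le_sum fun j _ => hstep j
  have hsplit : ∑ j ∈ Finset.Ico k n, (b j - s) = ∑ j ∈ Finset.Ico k n, b j - s * ((n : ℝ) - k) := by
    rw [Finset.sum_sub_distrib, Finset.sum_const, Nat.card_Ico, nsmul_eq_mul, Nat.cast_sub hkn]
    ring
  have hdr := sum_Ico_ge_of_drift hdrift hkn
  have hnk : (0 : ℝ) ≤ (n : ℝ) - k := by
    have : (k : ℝ) ≤ n := by exact_mod_cast hkn
    linarith
  have hs : 0 ≤ s := le_trans (mul_nonneg hCr (le_trans (le_of_lt (hg 0).1) (hg 0).2)) hγ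
  have hsnk : 0 ≤ s * ((n : ℝ) - k) := mul_nonneg hs hnk
  linarith

/-- **ENDPOINT EXISTENCE FROM A DRIFTING NAMED REFERENCE SEQUENCE AND A BOX REMAINDER** (forward-generated constructions): `OneLoopDrift s A b`,
`BoxRemainder β b C_r γ₀` with `0 ≤ C_r`, `C_r γ₀ ≤ s`, joint continuity (C) and the printed upper bound on `]0, γ₀]` ⇒ `DagBinding.EndpointExistence C`
(`FlowStepRuns.endpointExistence_of_partialSums` BY NAME).  The END of the K2⁷ named-jets road: NO `OneLoopSplit`, NO `limUnder`, NO reference history.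
Bookkeeping; nothing of the series is asserted. [cite: Balaban1987RG1, Thm 2 p.259 (first sentence) and (2.12)–(2.14) p.268] -/
theorem endpointExistence_of_drift_boxRemainder {C : B12.Construction} {β : HBeta} (hgen : ForwardGenerated C β) {b : ℕ → ℝ}
    {γ₀ s A Cr β' : ℝ} (hγ₀ : 0 < γ₀) (hdrift : OneLoopDrift s A b) (hrem : BoxRemainder β b Cr γ₀) (hCr : 0 ≤ Cr) (hγ : Cr * γ₀ ≤ s)
    (hβ' : 0 ≤ β') (hcont : BetaContH γ₀ β) (hup : BetaUpperH β' γ₀ β) : EndpointExistence C :=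
  endpointExistence_of_partialSums hgen hγ₀ (by linarith [hdrift.nonneg]) hβ' hcont
    (betaPartialSumsLowerH_of_drift_boxRemainder hdrift hrem hCr hγ) hup

/-- **A BOX REMAINDER DETERMINES ITS REFERENCE SEQUENCE**: if `β` is within `C_r·g_k` of `b_k` on `]0, γ₀]`-histories and within `C_r′·g_k` of `b′_k` on
`]0, γ₀′]`-histories (`0 < γ₀, γ₀′`), then `b = b′` (evaluate at the constant history `g` and let `g → 0⁺`).  So a named-jets remainder stub PINS the numbers
`beta0OfJs F κ` to the record's β outright: under it the colour datum `κ` is no free knob, and any two data satisfying it have the same one-loop numbers,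
hence the same (D1) drift. [folklore] -/
theorem boxRemainder_unique {β : HBeta} {b b' : ℕ → ℝ} {Cr Cr' γ₀ γ₀' : ℝ} (h : BoxRemainder β b Cr γ₀) (h' : BoxRemainder β b' Cr' γ₀')
    (hγ₀ : 0 < γ₀) (hγ₀' : 0 < γ₀') : b = b' := by
  funext k
  by_contra hne
  have hε : 0 < |b k - b' k| := abs_pos.mpr (sub_ne_zero.mpr hne)
  -- a constant admissible history `g` with `(|Cr| + |Cr'|) g < |b k − b' k|`
  set M : ℝ := |Cr| + |Cr'| + 1 with hM
  have hMpos : 0 < M := by positivity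
  set g : ℝ := min (min γ₀ γ₀') (|b k - b' k| / (2 * M)) with hgdef
  have hgpos : 0 < g := lt_min (lt_min hγ₀ hγ₀') (by positivity)
  have hgγ : g ≤ γ₀ := (min_le_left _ _).trans (min_le_left _ _)
  have hgγ' : g ≤ γ₀' := (min_le_left _ _).trans (min_le_right _ _)
  have hgε : g ≤ |b k - b' k| / (2 * M) := min_le_right _ _
  set p : Fin (k + 1) → ℝ := fun _ => g with hp
  have hpk : p (Fin.last k) = g := rfl
  have h1 := h k p fun _ => ⟨hgpos, hgγ⟩
  have h2 := h' k p fun _ => ⟨hgpos, hgγ'⟩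
  rw [hpk] at h1 h2
  have hCr : Cr * g ≤ |Cr| * g := mul_le_mul_of_nonneg_right (le_abs_self Cr) hgpos.le
  have hCr' : Cr' * g ≤ |Cr'| * g := mul_le_mul_of_nonneg_right (le_abs_self Cr') hgpos.le
  have htri : |b k - b' k| ≤ |β k p - b k| + |β k p - b' k| := by
    calc |b k - b' k| = |(β k p - b' k) - (β k p - b k)| := by ring_nf
      _ ≤ |β k p - b' k| + |β k p - b k| := abs_sub _ _
      _ = |β k p - b k| + |β k p - b' k| := add_comm _ _
  have hsum : |b k - b' k| ≤ (|Cr| + |Cr'|) * g := by linarith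
  have hlt : (|Cr| + |Cr'|) * g < |b k - b' k| := by
    have hle : (|Cr| + |Cr'|) * g ≤ M * g := mul_le_mul_of_nonneg_right (by linarith) hgpos.le
    have hMg : M * g ≤ M * (|b k - b' k| / (2 * M)) := mul_le_mul_of_nonneg_left hgε hMpos.le
    have hhalf : M * (|b k - b' k| / (2 * M)) = |b k - b' k| / 2 := by field_simp
    linarith
  linarith

end End

/-- **THE END OF THE K2⁷ NAMED-JETS ROAD AT A FORWARD-GENERATED CONSTRUCTION**: row (D1) over the named jets (`D1Drift F.L (JsOfRecord F κ) N 0 1`,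
positive numeral `N`), the box remainder of `β` relative to the named numbers `beta0OfJs F κ` with `C_r γ₀ ≤ stepBal N F.L`, (C) and the printed upper
bound ⇒ `EndpointExistence C`.  Both analytic inputs are HYPOTHESES (rows (D1) and (D4)∕B4 re-referenced); bookkeeping BY NAME. [folklore] -/
theorem endpointExistence_of_d1Drift_boxRemainder_JsOfRecord {C : B12.Construction} {β : HBeta} (hgen : ForwardGenerated C β) {N : ℝ}
    (hD1 : D1Drift F.L (JsOfRecord F κ) N 0 1) {γ₀ Cr β' : ℝ} (hγ₀ : 0 < γ₀) (hrem : BoxRemainder β (beta0OfJs F κ) Cr γ₀) (hCr : 0 ≤ Cr)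
    (hγ : Cr * γ₀ ≤ B12Normalization.stepBal N F.L) (hβ' : 0 ≤ β') (hcont : BetaContH γ₀ β) (hup : BetaUpperH β' γ₀ β) :
    EndpointExistence C := by
  obtain ⟨A, hdrift⟩ := (d1Drift_JsOfRecord_iff F κ N).mp hD1
  exact endpointExistence_of_drift_boxRemainder hgen hγ₀ hdrift hrem hCr hγ hβ' hcont hup

end Summit.QuantumFields.YangMills.Theorems.BalabanUVNodesK2JsOfRecord

end
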